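import Mathlib
import Literature.MathematicalPhysics.QuantumLattice.WilsonDiracAP
import Summits.QuantumFields.QCD.Theorems.QuarksAsStableActionCriticalLineDiamagnetismStubCellIncidence
import Summits.QuantumFields.QCD.Theorems.WilsonQuarkChessboardFlatCellOptimalStubCellGaugeAllN
import Summits.QuantumFields.QCD.Theorems.WilsonQuarkChessboardFlatCellOptimalGaugeOrbit

/-!
# The one-cell gain, `N` colours: from the cell gauge to the plaquette hypothesis (K tracked)
(helper for crux stmt-QuantumFields-9307 `FlatCellOptimal`, line `registered`, stub
`stub_localNormGain_of` (G4 transport), sub-goal `stub_cellGainOfGaugedAllN` — the `Fin 3 ↦ Fin N`,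
K-TRACKED port of the sibling crux stmt-QuantumFields-9734's `…CriticalLineDiamagnetismStubCellGainOfGauged`,
wave 8)

What.  Glue `(CellGainGauged) → (CellGain)` of the cell-gain chain, for EVERY colour number `N`, every
even `L ≥ 4`, in NORM form and with the additive constant `K` and the rate `c` of the exponent EXPLICIT and
UNCHANGED (`stub_cellGainOfGaugedAllN`): for every link threshold `η > 0` there is a plaquette threshold
`δ₀ > 0` (`δ₀ = η / (24 · max C 1)`, `C = 1920` the N-free cell-gauge constant) such that, at any fixed
`K, c, N, L, m, V, cell` and any Finset `CF` of plaquettes carrying the exponent, IF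
`‖det_AP[tile_cell W]‖ ≤ exp(K − c (L⁴/4) Σ_{p ∈ CF} dfc W p) · ‖det_AP[1]‖` holds for every `U(N)` field
`W` whose `32` closed-cell LINKS have deficit `N − Re tr W_e ≤ η`, THEN the same inequality (same `K`, same
`c`) holds for `V` as soon as the `24` cell PLAQUETTES of `V` have deficit `< δ₀`.  In the crux `K = 0`:
no additive slack is created by this step.  More generally (`CellGainOfGauged.cellGain_transfer`) ANY
property `P (det_AP[tile_cell W]) (Σ_{p ∈ CF} dfc W p)` of the pair (antiperiodic determinant of the
tiling, plaquette-deficit sum) transfers from link-good `W` to plaquette-good `V`.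

How (the sibling's proof, `3 ↦ N`).  (1) By the landed N-generic cell gauge
(`…FlatCellOptimal.CellGauge.stub_cellGaugeAllN`, G3, `C = 1920`) some gauge `g` makes the total deficit
of the 32 cell links of `W := V^g` at most `C ×` the total deficit of the 24 cell plaquettes of `V`
(`card ≤ 24` by the N-free `card_le_of_subset_cell` of the sibling's `…StubCellIncidence`); deficits are
`≥ 0` on `U(N)` (`deficit_nonneg`), so every cell link of `W` has deficit `≤ max(C,1) · 24 δ₀ = η` and the
hypothesis applies to `W`.  (2) `det_AP ∘ tile_cell` and the plaquette traces are GAUGE INVARIANT for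
every `N` (landed `…FlatCellOptimal.GaugeOrbit.apDet_tile_gaugeTransform` — fold identity
`tile_c (V^g) = (tile_c V)^{g ∘ fold_c}` for even `L`, the seam twist commutes with gauge transformations,
`det D_W` is gauge invariant — and the sibling's N-generic `trace_plaquetteHolonomy_gaugeTransform`), so
the statement for `W` is the statement for `V`.  `dAP` (at a fixed mass), `tile`, `dfc` enter through
their DEFINING EQUATIONS (matched by `fun _ => rfl` from the skeleton's abbreviations and the crux's
`let`s); the N-free `ZMod`/filter bookkeeping of the sibling file is re-EXPORTED into
`…CellGain.CellGainOfGauged` (aliases, no restatement).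

References: K. G. Wilson, Phys. Rev. D 10 (1974) 2445 (gauge invariance on the lattice); M. Creutz,
*Quarks, gluons and lattices* (1983) Ch. 9 (axial/tree gauges); Montvay–Münster, *Quantum Fields on a
Lattice* §5.1.1 (5.3)–(5.5) (gauge invariance of the quark determinant).  Pure theorem file (no
definitions).
-/

noncomputable section

open scoped BigOperators Classical Matrix ComplexConjugate
open Finset
open Literature.MathematicalPhysics.QuantumLattice Literature.MathematicalPhysics.QuantumFieldTheory
  Literature.Probability.LatticeModels

namespace Summit.QuantumFields.QCD.Cruxes.FlatCellOptimal.CellGain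

namespace CellGainOfGauged

/-! ### N-free bookkeeping of the sibling file and the landed gauge-orbit facts, re-exported -/

export Summit.QuantumFields.QCD.Cruxes.CriticalLineDiamagnetism.ChessboardCellGain.CellGainOfGauged
  (eq_of_val_sub_eq_zero eq_or_eq_add_one_of_val_sub_le_one mem_filter_univ_of of_mem_filter_univ
    zmod_val_add_one_mod_two trace_plaquetteHolonomy_gaugeTransform fold_shift_of_even
    shift_fold_shift_of_odd)

export Summit.QuantumFields.QCD.Cruxes.CriticalLineDiamagnetism.ChessboardCellGain
  (card_le_of_subset_cell seam_eq_apTwistAt')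

export Summit.QuantumFields.QCD.Cruxes.FlatCellOptimal.GaugeOrbit
  (det_seam_gaugeTransform apDet_gaugeTransform gaugeTransform_tile tile_gaugeTransform
    apDet_tile_gaugeTransform trace_plaquetteHolonomy_tile_gaugeTransform deficit_eq_zero_iff)

variable {N L : ℕ}

/-! ### Deficits on `U(N)` -/

/-- `Re tr u ≤ N` on `U(N)`: link and plaquette deficits are non-negative (every `N`). -/
theorem deficit_nonneg (u : Matrix.unitaryGroup (Fin N) ℂ) :
    0 ≤ (N : ℝ) - ((u : Matrix (Fin N) (Fin N) ℂ)).trace.re := by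
  -- adapted from `CellGainOfGauged.deficit_nonneg` of the sibling file (`3 ↦ N`)
  rw [sub_nonneg, Matrix.trace, Complex.re_sum]
  calc ∑ i, (Matrix.diag (u : Matrix (Fin N) (Fin N) ℂ) i).re
      ≤ ∑ _i : Fin N, (1 : ℝ) := Finset.sum_le_sum fun i _ =>
        (Complex.re_le_norm _).trans (entry_norm_bound_of_unitary u.2 i i)
    _ = N := by simp

/-- The same for the fundamental representation `ρ(u) = u`. -/
theorem deficit_rep_nonneg (u : Matrix.unitaryGroup (Fin N) ℂ) :
    0 ≤ (N : ℝ) - (unitaryFundamentalRep (Fin N) ℂ u).trace.re :=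
  deficit_nonneg u

/-! ### In a cell gauge every cell link is `η`-good -/

/-- **Link smallness in the cell gauge.**  If `Σ_{EF} deficit(W) ≤ C Σ_{PF} deficit(V)`, `EF` contains
the cell links, `PF` consists of cell plaquettes (so `card PF ≤ 24`), and the cell plaquettes of `V` have
deficit `< η / (24 · max C 1)`, then every cell link of `W` has deficit `≤ η`. -/
theorem links_le_of_cellGauge [NeZero L] {η C : ℝ}
    (V W : GaugeConfig 4 L (Matrix.unitaryGroup (Fin N) ℂ)) (cell : Site 4 L)
    {EF : Finset (Edge 4 L)} {PF : Finset (Plaquette 4 L)}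
    (hg : (∑ e ∈ EF, ((N : ℝ) - (((W e : Matrix.unitaryGroup (Fin N) ℂ) :
        Matrix (Fin N) (Fin N) ℂ)).trace.re)) ≤
      C * ∑ p ∈ PF, ((N : ℝ) - (((plaquetteHolonomy V p.1 p.2.1.1 p.2.1.2 :
        Matrix.unitaryGroup (Fin N) ℂ) : Matrix (Fin N) (Fin N) ℂ)).trace.re))
    (hEF : ∀ e : Edge 4 L, ((∀ ν, (e.1 ν - cell ν).val ≤ 1) ∧ (e.1 e.2 - cell e.2).val = 0) → e ∈ EF)
    (hPF : ∀ p ∈ PF, (∀ ν, (p.1 ν - cell ν).val ≤ 1) ∧ (p.1 p.2.1.1 - cell p.2.1.1).val = 0 ∧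
      (p.1 p.2.1.2 - cell p.2.1.2).val = 0)
    (hgood : ∀ p : Plaquette 4 L, (p.1 p.2.1.1 = cell p.2.1.1 ∧ p.1 p.2.1.2 = cell p.2.1.2 ∧
        ∀ ν, ν ≠ p.2.1.1 → ν ≠ p.2.1.2 → (p.1 ν = cell ν ∨ p.1 ν = cell ν + 1)) →
      (N : ℝ) - (((plaquetteHolonomy V p.1 p.2.1.1 p.2.1.2 : Matrix.unitaryGroup (Fin N) ℂ) :
        Matrix (Fin N) (Fin N) ℂ)).trace.re < η / (24 * max C 1)) :
    ∀ e : Edge 4 L, ((∀ ν, (e.1 ν - cell ν).val ≤ 1) ∧ (e.1 e.2 - cell e.2).val = 0) →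
      (N : ℝ) - ((W e : Matrix.unitaryGroup (Fin N) ℂ) : Matrix (Fin N) (Fin N) ℂ).trace.re ≤ η := by
  -- adapted from steps (1)–(2) of the sibling's `CellGainOfGauged.cellGain_glue` (`3 ↦ N`)
  have hPFcell : ∀ p ∈ PF, p.1 p.2.1.1 = cell p.2.1.1 ∧ p.1 p.2.1.2 = cell p.2.1.2 ∧
      ∀ κ, κ ≠ p.2.1.1 → κ ≠ p.2.1.2 → (p.1 κ = cell κ ∨ p.1 κ = cell κ + 1) := fun p hp => by
    obtain ⟨h1, h2, h3⟩ := hPF p hp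
    exact ⟨eq_of_val_sub_eq_zero h2, eq_of_val_sub_eq_zero h3,
      fun κ _ _ => eq_or_eq_add_one_of_val_sub_le_one (h1 κ)⟩
  have hcard : PF.card ≤ 24 := card_le_of_subset_cell cell PF hPFcell
  have hM : 0 < max C 1 := lt_of_lt_of_le one_pos (le_max_right _ _)
  -- `0 ≤ δ₀`: the cell plaquette `(cell; 0, 1)` has deficit in `[0, δ₀)`
  have hη : 0 ≤ η / (24 * max C 1) :=
    ((deficit_nonneg _).trans_lt
      (hgood ((cell, ⟨((0 : Fin 4), (1 : Fin 4)), by decide⟩) : Plaquette 4 L)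
        ⟨rfl, rfl, fun _ _ _ => Or.inl rfl⟩)).le
  have hS0 : 0 ≤ ∑ p ∈ PF, ((N : ℝ) - (((plaquetteHolonomy V p.1 p.2.1.1 p.2.1.2 :
      Matrix.unitaryGroup (Fin N) ℂ) : Matrix (Fin N) (Fin N) ℂ)).trace.re) :=
    Finset.sum_nonneg fun p _ => deficit_nonneg _
  have hSle : ∑ p ∈ PF, ((N : ℝ) - (((plaquetteHolonomy V p.1 p.2.1.1 p.2.1.2 :
      Matrix.unitaryGroup (Fin N) ℂ) : Matrix (Fin N) (Fin N) ℂ)).trace.re) ≤ 24 * (η / (24 * max C 1)) :=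
    calc ∑ p ∈ PF, ((N : ℝ) - (((plaquetteHolonomy V p.1 p.2.1.1 p.2.1.2 :
          Matrix.unitaryGroup (Fin N) ℂ) : Matrix (Fin N) (Fin N) ℂ)).trace.re)
        ≤ ∑ _p ∈ PF, η / (24 * max C 1) :=
          Finset.sum_le_sum fun p hp => (hgood p (hPFcell p hp)).le
      _ = PF.card * (η / (24 * max C 1)) := by rw [Finset.sum_const, nsmul_eq_mul]
      _ ≤ 24 * (η / (24 * max C 1)) := mul_le_mul_of_nonneg_right (by exact_mod_cast hcard) hη
  intro e he
  have h1 := Finset.single_le_sum (f := fun e : Edge 4 L =>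
      (N : ℝ) - (((W e : Matrix.unitaryGroup (Fin N) ℂ) : Matrix (Fin N) (Fin N) ℂ)).trace.re)
    (fun e _ => deficit_nonneg _) (hEF e he)
  have h3 : max C 1 * (24 * (η / (24 * max C 1))) = η := by
    field_simp
  calc (N : ℝ) - ((W e : Matrix.unitaryGroup (Fin N) ℂ) : Matrix (Fin N) (Fin N) ℂ).trace.re
      ≤ ∑ e ∈ EF, ((N : ℝ) - (((W e : Matrix.unitaryGroup (Fin N) ℂ) :
          Matrix (Fin N) (Fin N) ℂ)).trace.re) := h1
    _ ≤ C * ∑ p ∈ PF, ((N : ℝ) - (((plaquetteHolonomy V p.1 p.2.1.1 p.2.1.2 :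
          Matrix.unitaryGroup (Fin N) ℂ) : Matrix (Fin N) (Fin N) ℂ)).trace.re) := hg
    _ ≤ max C 1 * ∑ p ∈ PF, ((N : ℝ) - (((plaquetteHolonomy V p.1 p.2.1.1 p.2.1.2 :
          Matrix.unitaryGroup (Fin N) ℂ) : Matrix (Fin N) (Fin N) ℂ)).trace.re) :=
        mul_le_mul_of_nonneg_right (le_max_left _ _) hS0
    _ ≤ max C 1 * (24 * (η / (24 * max C 1))) := mul_le_mul_of_nonneg_left hSle hM.le
    _ = η := h3

/-! ### The transfer principle at fixed even `L` (every `N`) -/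

section Transfer

variable [NeZero L] {m : ℝ}
  {dAP : GaugeConfig 4 L (Matrix.unitaryGroup (Fin N) ℂ) → ℂ}
  {tile : Site 4 L → GaugeConfig 4 L (Matrix.unitaryGroup (Fin N) ℂ) →
    GaugeConfig 4 L (Matrix.unitaryGroup (Fin N) ℂ)}
  {dfc : GaugeConfig 4 L (Matrix.unitaryGroup (Fin N) ℂ) → Plaquette 4 L → ℝ}

/-- **Transfer principle (gauge fixing on one cell).**  Let `g` be a cell gauge for `V` at `cell`
(`Σ_{EF} deficit(V^g) ≤ C Σ_{PF} deficit(V)`, `EF ⊇` cell links, `PF ⊆` cell plaquettes) and let the cell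
plaquettes of `V` be `η / (24 max(C,1))`-good.  Then ANY property `P` of the pair
`(det_AP[tile_cell W], Σ_{p ∈ CF} dfc W p)` valid for all `W` with `η`-good cell links holds for `V`:
apply it to `W := V^g` and use the gauge invariance of `det_AP ∘ tile_cell` and of plaquette traces
(even `L`, every `N`). -/
theorem cellGain_transfer (hL : Even L) {η C : ℝ}
    (hdAP : ∀ V : GaugeConfig 4 L (Matrix.unitaryGroup (Fin N) ℂ), dAP V =
      (wilsonDirac (unitaryFundamentalRep (Fin N) ℂ)
        (fun e => if (e.1 e.2).val + 1 = L then -V e else V e) m 1).det)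
    (htile : ∀ (c : Site 4 L) (V : GaugeConfig 4 L (Matrix.unitaryGroup (Fin N) ℂ)) (e : Edge 4 L),
      tile c V e = if (e.1 e.2 - c e.2).val % 2 = 0
        then V (fun ν => c ν + (((e.1 ν - c ν).val % 2 : ℕ) : ZMod L), e.2)
        else (V (fun ν => c ν + (((Site.shift e.1 e.2 ν - c ν).val % 2 : ℕ) : ZMod L), e.2))⁻¹)
    (hdfc : ∀ (V : GaugeConfig 4 L (Matrix.unitaryGroup (Fin N) ℂ)) (p : Plaquette 4 L), dfc V p =
      (N : ℝ) - (unitaryFundamentalRep (Fin N) ℂ (plaquetteHolonomy V p.1 p.2.1.1 p.2.1.2)).trace.re)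
    (V : GaugeConfig 4 L (Matrix.unitaryGroup (Fin N) ℂ)) (cell : Site 4 L)
    (g : Site 4 L → Matrix.unitaryGroup (Fin N) ℂ)
    {EF : Finset (Edge 4 L)} {PF : Finset (Plaquette 4 L)}
    (hg : (∑ e ∈ EF, ((N : ℝ) - (((gaugeTransform g V e : Matrix.unitaryGroup (Fin N) ℂ) :
        Matrix (Fin N) (Fin N) ℂ)).trace.re)) ≤
      C * ∑ p ∈ PF, ((N : ℝ) - (((plaquetteHolonomy V p.1 p.2.1.1 p.2.1.2 :
        Matrix.unitaryGroup (Fin N) ℂ) : Matrix (Fin N) (Fin N) ℂ)).trace.re))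
    (hEF : ∀ e : Edge 4 L, ((∀ ν, (e.1 ν - cell ν).val ≤ 1) ∧ (e.1 e.2 - cell e.2).val = 0) → e ∈ EF)
    (hPF : ∀ p ∈ PF, (∀ ν, (p.1 ν - cell ν).val ≤ 1) ∧ (p.1 p.2.1.1 - cell p.2.1.1).val = 0 ∧
      (p.1 p.2.1.2 - cell p.2.1.2).val = 0)
    (CF : Finset (Plaquette 4 L)) (P : ℂ → ℝ → Prop)
    (hG : ∀ W : GaugeConfig 4 L (Matrix.unitaryGroup (Fin N) ℂ),
      (∀ e : Edge 4 L, ((∀ ν, (e.1 ν - cell ν).val ≤ 1) ∧ (e.1 e.2 - cell e.2).val = 0) →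
        (N : ℝ) - ((W e : Matrix.unitaryGroup (Fin N) ℂ) : Matrix (Fin N) (Fin N) ℂ).trace.re ≤ η) →
      P (dAP (tile cell W)) (∑ p ∈ CF, dfc W p))
    (hgood : ∀ p : Plaquette 4 L, (p.1 p.2.1.1 = cell p.2.1.1 ∧ p.1 p.2.1.2 = cell p.2.1.2 ∧
        ∀ ν, ν ≠ p.2.1.1 → ν ≠ p.2.1.2 → (p.1 ν = cell ν ∨ p.1 ν = cell ν + 1)) →
      dfc V p < η / (24 * max C 1)) :
    P (dAP (tile cell V)) (∑ p ∈ CF, dfc V p) := by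
  -- (1)–(2) in the cell gauge every cell link of `W := V^g` has deficit at most `η`
  have hlinks := links_le_of_cellGauge V (gaugeTransform g V) cell hg hEF hPF
    (fun p hp => by have h := hgood p hp; rw [hdfc] at h; exact h)
  -- (3) the property for `W`
  have key := hG (gaugeTransform g V) hlinks
  -- (4) plaquette deficits are gauge invariant
  have hsum : ∑ p ∈ CF, dfc (gaugeTransform g V) p = ∑ p ∈ CF, dfc V p :=
    Finset.sum_congr rfl fun p _ => by
      rw [hdfc, hdfc, trace_plaquetteHolonomy_gaugeTransform]
  -- (5) the antiperiodic determinant of the tiling is gauge invariant (fold identity + seam)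
  rw [apDet_tile_gaugeTransform hL hdAP htile g V cell, hsum] at key
  exact key

/-- **The glue at fixed `L`, norm form, `K` and `c` tracked**: the special case
`P z S :↔ ‖z‖ ≤ exp(K − c (L⁴/4) S) · ‖det_AP[1]‖` of `cellGain_transfer`. -/
theorem cellGain_glue (hL : Even L) {η C K c : ℝ}
    (hdAP : ∀ V : GaugeConfig 4 L (Matrix.unitaryGroup (Fin N) ℂ), dAP V =
      (wilsonDirac (unitaryFundamentalRep (Fin N) ℂ)
        (fun e => if (e.1 e.2).val + 1 = L then -V e else V e) m 1).det)
    (htile : ∀ (c : Site 4 L) (V : GaugeConfig 4 L (Matrix.unitaryGroup (Fin N) ℂ)) (e : Edge 4 L),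
      tile c V e = if (e.1 e.2 - c e.2).val % 2 = 0
        then V (fun ν => c ν + (((e.1 ν - c ν).val % 2 : ℕ) : ZMod L), e.2)
        else (V (fun ν => c ν + (((Site.shift e.1 e.2 ν - c ν).val % 2 : ℕ) : ZMod L), e.2))⁻¹)
    (hdfc : ∀ (V : GaugeConfig 4 L (Matrix.unitaryGroup (Fin N) ℂ)) (p : Plaquette 4 L), dfc V p =
      (N : ℝ) - (unitaryFundamentalRep (Fin N) ℂ (plaquetteHolonomy V p.1 p.2.1.1 p.2.1.2)).trace.re)
    (V : GaugeConfig 4 L (Matrix.unitaryGroup (Fin N) ℂ)) (cell : Site 4 L)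
    (g : Site 4 L → Matrix.unitaryGroup (Fin N) ℂ)
    {EF : Finset (Edge 4 L)} {PF : Finset (Plaquette 4 L)}
    (hg : (∑ e ∈ EF, ((N : ℝ) - (((gaugeTransform g V e : Matrix.unitaryGroup (Fin N) ℂ) :
        Matrix (Fin N) (Fin N) ℂ)).trace.re)) ≤
      C * ∑ p ∈ PF, ((N : ℝ) - (((plaquetteHolonomy V p.1 p.2.1.1 p.2.1.2 :
        Matrix.unitaryGroup (Fin N) ℂ) : Matrix (Fin N) (Fin N) ℂ)).trace.re))
    (hEF : ∀ e : Edge 4 L, ((∀ ν, (e.1 ν - cell ν).val ≤ 1) ∧ (e.1 e.2 - cell e.2).val = 0) → e ∈ EF)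
    (hPF : ∀ p ∈ PF, (∀ ν, (p.1 ν - cell ν).val ≤ 1) ∧ (p.1 p.2.1.1 - cell p.2.1.1).val = 0 ∧
      (p.1 p.2.1.2 - cell p.2.1.2).val = 0)
    (CF : Finset (Plaquette 4 L))
    (hG : ∀ W : GaugeConfig 4 L (Matrix.unitaryGroup (Fin N) ℂ),
      (∀ e : Edge 4 L, ((∀ ν, (e.1 ν - cell ν).val ≤ 1) ∧ (e.1 e.2 - cell e.2).val = 0) →
        (N : ℝ) - ((W e : Matrix.unitaryGroup (Fin N) ℂ) : Matrix (Fin N) (Fin N) ℂ).trace.re ≤ η) →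
      ‖dAP (tile cell W)‖ ≤
        Real.exp (K - c * ((L : ℝ) ^ 4 / 4) * ∑ p ∈ CF, dfc W p) * ‖dAP 1‖)
    (hgood : ∀ p : Plaquette 4 L, (p.1 p.2.1.1 = cell p.2.1.1 ∧ p.1 p.2.1.2 = cell p.2.1.2 ∧
        ∀ ν, ν ≠ p.2.1.1 → ν ≠ p.2.1.2 → (p.1 ν = cell ν ∨ p.1 ν = cell ν + 1)) →
      dfc V p < η / (24 * max C 1)) :
    ‖dAP (tile cell V)‖ ≤ Real.exp (K - c * ((L : ℝ) ^ 4 / 4) * ∑ p ∈ CF, dfc V p) * ‖dAP 1‖ :=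
  cellGain_transfer hL hdAP htile hdfc V cell g hg hEF hPF CF
    (fun z S => ‖z‖ ≤ Real.exp (K - c * ((L : ℝ) ^ 4 / 4) * S) * ‖dAP 1‖) hG hgood

end Transfer

end CellGainOfGauged

/-- **Sub-goal `stub_cellGainOfGaugedAllN` (G4 port, wave 8) — `cellGain_of_gauged` for `Fin N`, `K`
tracked.**  For every `η > 0` there is `δ₀ > 0` (`= η / (24 · max C 1)`, `C` the N-free cell-gauge constant
of `stub_cellGaugeAllN`) such that for all `K c : ℝ`, all `N`, all even `L ≥ 4`, every mass `m` (the items'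
`dAP` at mass `m`, `tile`, `dfc` given by their defining equations), every `V`, `cell` and every plaquette
Finset `CF`: if `‖dAP (tile cell W)‖ ≤ exp(K − c (L⁴/4) Σ_{p ∈ CF} dfc W p) ‖dAP 1‖` for every `W` whose
closed-cell links have deficit `≤ η`, and the closed-cell plaquettes of `V` have deficit `< δ₀`, then
`‖dAP (tile cell V)‖ ≤ exp(K − c (L⁴/4) Σ_{p ∈ CF} dfc V p) ‖dAP 1‖` — the SAME `K` and `c`. -/
theorem stub_cellGainOfGaugedAllN : ∀ (η : ℝ), 0 < η → ∃ δ₀ : ℝ, 0 < δ₀ ∧ ∀ (K c : ℝ) (N L : ℕ) [NeZero L], Even L → 4 ≤ L → ∀ (m : ℝ) (dAP : GaugeConfig 4 L (Matrix.unitaryGroup (Fin N) ℂ) → ℂ) (tile : Site 4 L → GaugeConfig 4 L (Matrix.unitaryGroup (Fin N) ℂ) → GaugeConfig 4 L (Matrix.unitaryGroup (Fin N) ℂ)) (dfc : GaugeConfig 4 L (Matrix.unitaryGroup (Fin N) ℂ) → Plaquette 4 L → ℝ), (∀ V, dAP V = (wilsonDirac (unitaryFundamentalRep (Fin N) ℂ)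 (fun e => if (e.1 e.2).val + 1 = L then -V e else V e) m 1).det) → (∀ (c : Site 4 L) (V : GaugeConfig 4 L (Matrix.unitaryGroup (Fin N) ℂ)) (e : Edge 4 L), tile c V e = if (e.1 e.2 - c e.2).val % 2 = 0 then V (fun ν => c ν + (((e.1 ν - c ν).val % 2 : ℕ) : ZMod L), e.2) else (V (fun ν => c ν + (((Site.shift e.1 e.2 ν - c ν).val % 2 : ℕ) : ZMod L), e.2))⁻¹) → (∀ (V : GaugeConfig 4 L (Matrix.unitaryGroup (Fin N) ℂ)) (p : Plaquette 4 L), dfc V p = (N : ℝ) - (unitaryFundamentalRep (Fin N) ℂ (plaquetteHolonomy V p.1 p.2.1.1 p.2.1.2)).trace.re) → ∀ (V : GaugeConfig 4 L (Matrix.unitaryGroup (Fin N) ℂ)) (cell : Site 4 L) (CF : Finset (Plaquette 4 L)), (∀ W : GaugeConfig 4 L (Matrix.unitaryGroup (Fin N) ℂ), (∀ e : Edge 4 L, ((∀ ν, (e.1 ν - cell ν).val ≤ 1) ∧ (e.1 e.2 - cell e.2).val = 0) → (N : ℝ) - ((W e : Matrix.unitaryGroup (Fin N) ℂ) : Matrix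 (Fin N) (Fin N) ℂ).trace.re ≤ η) → ‖dAP (tile cell W)‖ ≤ Real.exp (K - c * ((L : ℝ) ^ 4 / 4) * ∑ p ∈ CF, dfc W p) * ‖dAP 1‖) → (∀ p : Plaquette 4 L, (p.1 p.2.1.1 = cell p.2.1.1 ∧ p.1 p.2.1.2 = cell p.2.1.2 ∧ ∀ ν, ν ≠ p.2.1.1 → ν ≠ p.2.1.2 → (p.1 ν = cell ν ∨ p.1 ν = cell ν + 1)) → dfc V p < δ₀) → ‖dAP (tile cell V)‖ ≤ Real.exp (K - c * ((L : ℝ) ^ 4 / 4) * ∑ p ∈ CF, dfc V p) * ‖dAP 1‖ := by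
  intro η hη
  obtain ⟨C, hC⟩ := Summit.QuantumFields.QCD.Cruxes.FlatCellOptimal.CellGauge.stub_cellGaugeAllN
  have hM : 0 < max C 1 := lt_of_lt_of_le one_pos (le_max_right _ _)
  refine ⟨η / (24 * max C 1), by positivity, ?_⟩
  intro K c N L _ hL h4 m dAP tile dfc hdAP htile hdfc V cell CF hG hgood
  obtain ⟨g, hg⟩ := hC N L h4 V cell
  exact CellGainOfGauged.cellGain_glue hL hdAP htile hdfc V cell g hg
    (fun e he => CellGainOfGauged.mem_filter_univ_of he)
    (fun p hp => (CellGainOfGauged.of_mem_filter_univ hp :)) CF hG hgood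

end Summit.QuantumFields.QCD.Cruxes.FlatCellOptimal.CellGain

end
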